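import Mathlib
import Literature.Analysis.ODE.CarlemanTruncationKronecker

/-!
# DEQ-A207 receipt — Carleman block weight and rescaling covariance (OURS; DEQ-A207 §6.3)

HONEST FRAMING: instance-level adjudication of specific advantage claims; no claim about
BQP vs BPP or the summit.

Context (informal, not formalised).  Wang–Jiang–Fan–Jia–Eisert–Liu–Liu, arXiv:2502.14252v2,
Thms III.1/III.2, prepare the normalised stacked Carleman history
`|Y⟩ ∝ ((ŷ₁,…,ŷ_N)(t₀), …, (ŷ₁,…,ŷ_N)(t_M))` of a sampling recursion in the SAMPLE variable
`x ∈ ℝ^D`, `ŷ_j ≈ x^{⊗j}`, and read the generated sample off the block `ŷ₁(t_M)`.  DEQ-A207 §6.3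
observes that the weight of that block is `‖x‖² / ‖Y‖²`, and that by the tree fact
`Literature.Analysis.ODE.Carleman.norm_toLp_kronPow` (`‖x^{⊗j}‖ = ‖x‖^j`,
[LiuEtAl2021Carleman] Cor. 1 proof) one has, whenever `‖x‖ ≥ 1`,
`N · ‖x‖² ≤ Σ_{j=1}^{N} ‖x^{⊗j}‖²` and `‖x‖^{2N} ≤ Σ_{j=1}^{N} ‖x^{⊗j}‖²` — so the block weight is at
most `1/N` and at most `‖x‖^{2−2N}` unless the variable is rescaled to norm `≤ 1`; and rescaling
`x = c z` multiplies the `j`-th Carleman variable by `c^j` (`kronPow_smul`), hence the degree-`q`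
coefficient tensor by `c^{q−1}`.  With `x_T ~ N(0, σ̃² I_D)` one has `c ≈ σ̃ √D`.  Only these
elementary facts are formalised; nothing about algorithms, probability or complexity classes.
-/

noncomputable section

open Finset WithLp

namespace Summit.QuantumAdvantage.Dequantization.CarlemanBlockWeight

open Literature.Analysis.ODE.Carleman

variable {n : Type*} [Fintype n]

omit [Fintype n] in
/-- Rescaling covariance of the Carleman variables: `(c • v)^{⊗j} = c^j • v^{⊗j}`
(multilinearity; the tree's `kronPow j v m = ∏ i, v (m i)`). -/
theorem kronPow_smul (j : ℕ) (c : ℝ) (v : n → ℝ) :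
    kronPow j (c • v) = c ^ j • kronPow j v := by
  funext m
  simp only [kronPow, Pi.smul_apply, smul_eq_mul]
  rw [prod_mul_distrib, prod_const, card_univ, Fintype.card_fin]

/-- For `t ≥ 1` and `j ≥ 1`: `t² ≤ t^{2j}`. -/
theorem sq_le_pow_two_mul {t : ℝ} (ht : 1 ≤ t) {j : ℕ} (hj : 1 ≤ j) :
    t ^ 2 ≤ t ^ (2 * j) :=
  pow_le_pow_right₀ ht (by omega)

/-- Block-weight bound, counting form: `N · t² ≤ Σ_{j=1}^{N} t^{2j}` for `t ≥ 1`
(so the first block of a vector with block norms `t, t², …, t^N` carries weight `≤ 1/N`). -/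
theorem card_mul_sq_le_sum_pow {t : ℝ} (ht : 1 ≤ t) (N : ℕ) :
    (N : ℝ) * t ^ 2 ≤ ∑ j ∈ Icc 1 N, t ^ (2 * j) := by
  have hc : (Icc 1 N).card = N := by simp
  calc (N : ℝ) * t ^ 2 = ∑ _j ∈ Icc 1 N, t ^ 2 := by rw [sum_const, hc, nsmul_eq_mul]
    _ ≤ ∑ j ∈ Icc 1 N, t ^ (2 * j) :=
        sum_le_sum fun j hj => sq_le_pow_two_mul ht (mem_Icc.mp hj).1

/-- Block-weight bound, exponential form: `t^{2N} ≤ Σ_{j=1}^{N} t^{2j}` for `t ≥ 0`, `N ≥ 1`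
(so the first block carries weight `≤ t^{2-2N}` when `t ≥ 1`). -/
theorem pow_le_sum_pow {t : ℝ} (ht : 0 ≤ t) {N : ℕ} (hN : 1 ≤ N) :
    t ^ (2 * N) ≤ ∑ j ∈ Icc 1 N, t ^ (2 * j) :=
  single_le_sum (f := fun j => t ^ (2 * j)) (fun j _ => by positivity) (mem_Icc.mpr ⟨hN, le_rfl⟩)

/-- The tree fact restated for squares: `‖x^{⊗j}‖² = ‖x‖^{2j}` (Euclidean norms). -/
theorem norm_kronPow_sq (j : ℕ) (x : n → ℝ) :
    ‖(toLp 2 (kronPow j x) : EuclideanSpace ℝ (Fin j → n))‖ ^ 2 =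
      ‖(toLp 2 x : EuclideanSpace ℝ n)‖ ^ (2 * j) := by
  rw [norm_toLp_kronPow, ← pow_mul, mul_comm]

/-- **DEQ-A207 §6.3, first-block weight.** If `‖x‖ ≥ 1` then
`N · ‖x‖² ≤ Σ_{j=1}^{N} ‖x^{⊗j}‖²`: inside the stacked Carleman vector `(x, x^{⊗2}, …, x^{⊗N})`
the block one measures carries at most a `1/N` fraction of the squared norm. -/
theorem first_block_weight_le (x : n → ℝ) (hx : 1 ≤ ‖(toLp 2 x : EuclideanSpace ℝ n)‖) (N : ℕ) :
    (N : ℝ) * ‖(toLp 2 x : EuclideanSpace ℝ n)‖ ^ 2 ≤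
      ∑ j ∈ Icc 1 N, ‖(toLp 2 (kronPow j x) : EuclideanSpace ℝ (Fin j → n))‖ ^ 2 := by
  simp_rw [norm_kronPow_sq]
  exact card_mul_sq_le_sum_pow hx N

/-- **DEQ-A207 §6.3, exponential form.** For `N ≥ 1`,
`‖x‖^{2N} ≤ Σ_{j=1}^{N} ‖x^{⊗j}‖²`: when `‖x‖ > 1` the measured block's weight
`‖x‖² / Σ_j ‖x^{⊗j}‖²` is at most `‖x‖^{2-2N}`, exponentially small in the truncation order. -/
theorem top_block_le_sum (x : n → ℝ) {N : ℕ} (hN : 1 ≤ N) :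
    ‖(toLp 2 x : EuclideanSpace ℝ n)‖ ^ (2 * N) ≤
      ∑ j ∈ Icc 1 N, ‖(toLp 2 (kronPow j x) : EuclideanSpace ℝ (Fin j → n))‖ ^ 2 := by
  simp_rw [norm_kronPow_sq]
  exact pow_le_sum_pow (norm_nonneg _) hN

end Summit.QuantumAdvantage.Dequantization.CarlemanBlockWeight

end
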